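import Summits.NavierStokesRegularity.FluidComputer.PalasekTowerFaceConstants

/-!
# The τ₁ faces of the register as universal Navier–Stokes constants, II: the necessity lemmas, PROVED
# (crux idea `universal-face-constants`, stmt-NavierStokesRegularity-19179)

Cell `ns-blowup`, seat `ns-palasek-19179-p2` (g2; holder of record of the crux `EpisodeBase` = `EpisodeBaseG` of the route
`PalasekTowerBreakdown`, item stmt-NavierStokesRegularity-19179, line `slot`). Sequel of `PalasekTowerFaceConstants.lean`
(vocabulary). STATEMENTS = the three First-lemma signatures of the crux idea card
`Cruxes/EpisodeBase/Ideas/universal-face-constants.md` (seat `ns-plan-lens-dual` g0, 19179 evidence #53/#54; critic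
ns-mechcritic-2 NEW-COMBINATION, evidence #58, USE (a); refuter4 K90), verbatim up to the namespace; PROOFS = this file
(M-sized register unpacking, every `k`). LABEL: E–C typing (KERNEL lemmas). WHAT THIS IS NOT: not Navier–Stokes evidence
— the theorems say which EXPLICIT a-priori constants, IF ever certified BELOW the registered face ratios, would empty level
`k + 1` of the register (and at `k = 0` refute the crux); no such constant is asserted, none is in print, and the
closed-form envelope (K90 (3)) does not expect the doors to fire. METERS for primal designs, not kills.

## Contents

* §1 statements `GradientFaceNecessity k`, `SpeedFaceNecessity k`, `SpeedFaceNecessityAnchored`;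
* §2 proofs for every `k`: `gradientFaceNecessity`, `speedFaceNecessity`, `speedFaceNecessityAnchored` — unpack a
  level-`(k+1)` stage on its last window `[τ_k, τ_{k+1}]`: classical there (`Stage.classical` restricted), finite energy,
  force `≤ Y_k` pointwise (`force_le_Y_of_rigid`), speed `≤ c₂ Y_{k+1}` (`Stage.ceiling`), start speed `≤ c₂ Y_k`
  (resp. `≤ c₁ Y₀` everywhere by the GLOBAL ANCHOR, `Stage.norm_τ_zero_le`), window length `w_k` (`Rigid.window_eq`);
  the hypothesised bound then contradicts the strain floor `c₁ A_{k+1}` (`Stage.routeG_strain`) resp. the speed floor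
  `c₁ Y_{k+1}` (`Stage.floor`);
* §3 the dual doors packaged: `not_episodeBaseG_of_gradientProductionBound` (`κ < 0.0578` at `s = 3826.5`),
  `not_episodeBaseG_of_speedAmplificationBound` (`a < 1.234` at `(905.0, 2.056)`),
  `not_episodeBaseG_of_speedAmplificationBound_anchored` (`a < 2.056` at `(325.8, 3.427)`), and the sterile reading one
  level up `heredityFrom_two_and_of_gradientProductionBound_one`.

References: S. Palasek, arXiv:2605.13827 §3.3, §4 [cite: Palasek2026ElementaryModel, §3.3]; G. Seregin, *Lecture Notes on
Regularity Theory for the Navier–Stokes Equations* (2014), Prop. 3.9 [cite: Seregin2014, Prop. 3.9].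
-/

noncomputable section

namespace Summit.NavierStokesRegularity.FluidComputer.PalasekTowerClayBridge

open Set MeasureTheory Filter Topology Function
open scoped ENNReal ContDiff NNReal
open Literature.Analysis.FluidPDE

namespace UniversalFace

/-! ## §1 The necessity statements (the First lemmas of the card) -/

/-- FIRST LEMMA G_k (statement): a gradient-production bound at the window-`k` parameters (ceiling units) with a
constant strictly below the registered floor ratio, valid for forces up to the window budget, empties level `k + 1`.
[cite: Palasek2026ElementaryModel, §3.3] -/
def GradientFaceNecessity (k : ℕ) : Prop :=
  ∀ κ φ : ℝ, GradientProductionBound (windowCeil k) φ κ → forceCeil k ≤ φ →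
    κ < gradFloorCeil k → NoStageAbove k

/-- FIRST LEMMA S_k (statement; start units `m = c₂ Y_k`): a speed-amplification bound at the window-`k` parameters
with a constant strictly below the floor-over-start ratio empties level `k + 1`. [cite: Palasek2026ElementaryModel, §3.3] -/
def SpeedFaceNecessity (k : ℕ) : Prop :=
  ∀ a φ : ℝ, SpeedAmplificationBound (windowStart k) (runRatio k) φ a → forceStart k ≤ φ →
    a < floorOverStart k → NoStageAbove k

/-- FIRST LEMMA S₀ᴬ (statement; anchored level `0`, start speed `c₁ Y₀` everywhere by the global anchor): a
speed-amplification bound at `(w₀ Y₀², (5/3) Y₁/Y₀, φ)` with constant `< Y₁/Y₀` empties level `1`.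
[cite: Palasek2026ElementaryModel, §3.3] -/
def SpeedFaceNecessityAnchored : Prop :=
  ∀ a φ : ℝ, SpeedAmplificationBound windowAnch runAnch φ a → forceAnch ≤ φ →
    a < floorAnch → NoStageAbove 0

/-! ## §2 The proofs -/

/-- **FIRST LEMMA G_k, PROVED (every `k`).** Unpacking of a level-`(k+1)` stage on its last window: classical on
`[τ_k, τ_{k+1}]` (`Stage.classical` restricted), finite energy (`Stage.energy`), force `≤ Y_k = forceCeil k · M³ ≤ φ M³`
(`push_small`, `c₄ ≤ c₁ = 1`), speed `≤ M = (5/3) Y_{k+1}` (`Stage.ceiling (k+1)`), window length `w_k`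
(`Rigid.window_eq`) so `T M² = windowCeil k`; the bound then caps `‖∇u(τ_{k+1})‖` by `κ M² < gradFloorCeil k · M² =
A_{k+1} = c₁ A_{k+1}`, against the strain floor of the route-G margin (`Stage.routeG_strain`).
[cite: Palasek2026ElementaryModel, §3.3] -/
theorem gradientFaceNecessity (k : ℕ) : GradientFaceNecessity k := by
  intro κ φ hB hφ hκ S hP hR hQ
  refine ⟨fun s => ?_⟩
  have hY1 := Y_pos (k + 1)
  have hYk := Y_pos k
  have hM : 0 < (5 / 3 : ℝ) * TowerRates.wide.Y (k + 1) := by positivity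
  have hMne : (5 / 3 : ℝ) * TowerRates.wide.Y (k + 1) ≠ 0 := ne_of_gt hM
  have hT : 0 < S.τ (k + 1) - S.τ k := by linarith [S.τ_lt_succ k]
  have e : S.τ k + (S.τ (k + 1) - S.τ k) = S.τ (k + 1) := by ring
  have hTM : (S.τ (k + 1) - S.τ k) * ((5 / 3 : ℝ) * TowerRates.wide.Y (k + 1)) ^ 2 = windowCeil k := by
    rw [window_eq_of_rigid hR k]
    rfl
  have hsub : Icc (S.τ k) (S.τ (k + 1)) ⊆ Icc 0 (S.τ (k + 1)) := Icc_subset_Icc_left (S.τ_pos k).le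
  have hcl : IsClassicalNSSolutionOn (Icc (S.τ k) (S.τ k + (S.τ (k + 1) - S.τ k))) 1 S.f s.u s.p := by
    rw [e]
    exact s.classical.mono hsub (uniqueDiffOn_Icc (S.τ_lt_succ k))
  have hen : ∃ C : ℝ≥0∞, C < ⊤ ∧ ∀ t ∈ Icc (S.τ k) (S.τ k + (S.τ (k + 1) - S.τ k)),
      ∫⁻ x, ‖s.u t x‖ₑ ^ 2 ≤ C := by
    rw [e]
    obtain ⟨C, hC, hb⟩ := s.energy
    exact ⟨C, hC, fun t ht => hb t (hsub ht)⟩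
  have hfo : ∀ t ∈ Icc (S.τ k) (S.τ k + (S.τ (k + 1) - S.τ k)), ∀ x,
      ‖S.f t x‖ ≤ φ * ((5 / 3 : ℝ) * TowerRates.wide.Y (k + 1)) ^ 3 := by
    rw [e]
    intro t ht x
    have h3 : TowerRates.wide.Y k = forceCeil k * ((5 / 3 : ℝ) * TowerRates.wide.Y (k + 1)) ^ 3 := by
      simp only [forceCeil]
      field_simp
    calc ‖S.f t x‖ ≤ TowerRates.wide.Y k := force_le_Y_of_rigid hR k ht x
      _ = forceCeil k * ((5 / 3 : ℝ) * TowerRates.wide.Y (k + 1)) ^ 3 := h3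
      _ ≤ φ * ((5 / 3 : ℝ) * TowerRates.wide.Y (k + 1)) ^ 3 :=
          mul_le_mul_of_nonneg_right hφ (by positivity)
  have hsp : ∀ t ∈ Icc (S.τ k) (S.τ k + (S.τ (k + 1) - S.τ k)), ∀ x,
      ‖s.u t x‖ ≤ (5 / 3 : ℝ) * TowerRates.wide.Y (k + 1) := by
    rw [e]
    intro t ht x
    have := s.ceiling (k + 1) le_rfl t (hsub ht) x
    rwa [hR.c₂_eq] at this
  have key := hB (S.τ k) (S.τ (k + 1) - S.τ k) ((5 / 3 : ℝ) * TowerRates.wide.Y (k + 1)) S.f s.u s.p hT hM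
    hTM hcl hen hfo hsp
  rw [e] at key
  obtain ⟨x, -, hx⟩ := s.routeG_strain (k + 1) le_rfl
  rw [hR.c₁_eq, one_mul] at hx
  have hkx := key x
  have hfl : gradFloorCeil k * ((5 / 3 : ℝ) * TowerRates.wide.Y (k + 1)) ^ 2 = TowerRates.wide.A (k + 1) := by
    simp only [gradFloorCeil]
    field_simp
  have hlt : κ * ((5 / 3 : ℝ) * TowerRates.wide.Y (k + 1)) ^ 2 <
      gradFloorCeil k * ((5 / 3 : ℝ) * TowerRates.wide.Y (k + 1)) ^ 2 :=
    mul_lt_mul_of_pos_right hκ (by positivity)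
  linarith

/-- **FIRST LEMMA S_k, PROVED (every `k`).** Same unpacking in start units `m = c₂ Y_k`: start speed `≤ m` at `τ_k`
(`Stage.ceiling k`), running bound `≤ c₂ Y_{k+1} = runRatio k · m` (`Stage.ceiling (k+1)`), force
`≤ Y_k = forceStart k · m³`; the bound caps the speed at `τ_{k+1}` by `a m < floorOverStart k · m = c₁ Y_{k+1}`, against
the velocity floor (`Stage.floor (k+1)`). [cite: Palasek2026ElementaryModel, §3.3] -/
theorem speedFaceNecessity (k : ℕ) : SpeedFaceNecessity k := by
  intro a φ hB hφ ha S hP hR hQ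
  refine ⟨fun s => ?_⟩
  have hY1 := Y_pos (k + 1)
  have hYk := Y_pos k
  have hm : 0 < (5 / 3 : ℝ) * TowerRates.wide.Y k := by positivity
  have hmne : (5 / 3 : ℝ) * TowerRates.wide.Y k ≠ 0 := ne_of_gt hm
  have hYkne : TowerRates.wide.Y k ≠ 0 := ne_of_gt hYk
  have hT : 0 < S.τ (k + 1) - S.τ k := by linarith [S.τ_lt_succ k]
  have e : S.τ k + (S.τ (k + 1) - S.τ k) = S.τ (k + 1) := by ring
  have hTm : (S.τ (k + 1) - S.τ k) * ((5 / 3 : ℝ) * TowerRates.wide.Y k) ^ 2 = windowStart k := by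
    rw [window_eq_of_rigid hR k]
    rfl
  have hsub : Icc (S.τ k) (S.τ (k + 1)) ⊆ Icc 0 (S.τ (k + 1)) := Icc_subset_Icc_left (S.τ_pos k).le
  have hcl : IsClassicalNSSolutionOn (Icc (S.τ k) (S.τ k + (S.τ (k + 1) - S.τ k))) 1 S.f s.u s.p := by
    rw [e]
    exact s.classical.mono hsub (uniqueDiffOn_Icc (S.τ_lt_succ k))
  have hen : ∃ C : ℝ≥0∞, C < ⊤ ∧ ∀ t ∈ Icc (S.τ k) (S.τ k + (S.τ (k + 1) - S.τ k)),
      ∫⁻ x, ‖s.u t x‖ₑ ^ 2 ≤ C := by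
    rw [e]
    obtain ⟨C, hC, hb⟩ := s.energy
    exact ⟨C, hC, fun t ht => hb t (hsub ht)⟩
  have hfo : ∀ t ∈ Icc (S.τ k) (S.τ k + (S.τ (k + 1) - S.τ k)), ∀ x,
      ‖S.f t x‖ ≤ φ * ((5 / 3 : ℝ) * TowerRates.wide.Y k) ^ 3 := by
    rw [e]
    intro t ht x
    have h3 : TowerRates.wide.Y k = forceStart k * ((5 / 3 : ℝ) * TowerRates.wide.Y k) ^ 3 := by
      simp only [forceStart]
      field_simp
    calc ‖S.f t x‖ ≤ TowerRates.wide.Y k := force_le_Y_of_rigid hR k ht x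
      _ = forceStart k * ((5 / 3 : ℝ) * TowerRates.wide.Y k) ^ 3 := h3
      _ ≤ φ * ((5 / 3 : ℝ) * TowerRates.wide.Y k) ^ 3 := mul_le_mul_of_nonneg_right hφ (by positivity)
  have hst : ∀ x, ‖s.u (S.τ k) x‖ ≤ (5 / 3 : ℝ) * TowerRates.wide.Y k := by
    intro x
    have := s.ceiling k (Nat.le_succ k) (S.τ k) ⟨(S.τ_pos k).le, le_rfl⟩ x
    rwa [hR.c₂_eq] at this
  have hrun : ∀ t ∈ Icc (S.τ k) (S.τ k + (S.τ (k + 1) - S.τ k)), ∀ x,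
      ‖s.u t x‖ ≤ runRatio k * ((5 / 3 : ℝ) * TowerRates.wide.Y k) := by
    rw [e]
    intro t ht x
    have h1 := s.ceiling (k + 1) le_rfl t (hsub ht) x
    rw [hR.c₂_eq] at h1
    have h2 : runRatio k * ((5 / 3 : ℝ) * TowerRates.wide.Y k) = (5 / 3 : ℝ) * TowerRates.wide.Y (k + 1) := by
      simp only [runRatio]
      field_simp
    rw [h2]
    exact h1
  have key := hB (S.τ k) (S.τ (k + 1) - S.τ k) ((5 / 3 : ℝ) * TowerRates.wide.Y k) S.f s.u s.p hT hm hTm hcl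
    hen hfo hst hrun
  rw [e] at key
  obtain ⟨x, -, hx⟩ := s.floor (k + 1) le_rfl
  rw [hR.c₁_eq, one_mul] at hx
  have hkx := key x
  have hfl : floorOverStart k * ((5 / 3 : ℝ) * TowerRates.wide.Y k) = TowerRates.wide.Y (k + 1) := by
    simp only [floorOverStart]
    field_simp
  have hlt : a * ((5 / 3 : ℝ) * TowerRates.wide.Y k) < floorOverStart k * ((5 / 3 : ℝ) * TowerRates.wide.Y k) :=
    mul_lt_mul_of_pos_right ha hm
  linarith

/-- **FIRST LEMMA S₀ᴬ, PROVED.** At level `0` the GLOBAL ANCHOR sharpens the start speed: `‖u (τ₀) x‖ ≤ c₁ Y₀ = Y₀`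
for EVERY `x` (`Stage.norm_τ_zero_le`: speed `< c₁ Y₀` on `[0, τ₀)` and continuity from the left); running bound
`(5/3) Y₁ = runAnch · Y₀`, force `≤ Y₀ = forceAnch · Y₀³`, window `w₀ Y₀² = windowAnch`; the bound caps the speed at
`τ₁` by `a Y₀ < floorAnch · Y₀ = Y₁ = c₁ Y₁`, against the level-`1` floor. [cite: Palasek2026ElementaryModel, §3.3] -/
theorem speedFaceNecessityAnchored : SpeedFaceNecessityAnchored := by
  intro a φ hB hφ ha S hP hR hQ
  refine ⟨fun s => ?_⟩
  have hY1 := Y_pos 1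
  have hY0 := Y_pos 0
  have hY0ne : TowerRates.wide.Y 0 ≠ 0 := ne_of_gt hY0
  have hT : 0 < S.τ 1 - S.τ 0 := by linarith [S.τ_lt_succ 0]
  have e : S.τ 0 + (S.τ 1 - S.τ 0) = S.τ 1 := by ring
  have hTm : (S.τ 1 - S.τ 0) * TowerRates.wide.Y 0 ^ 2 = windowAnch := by
    rw [window_eq_of_rigid hR 0]
    rfl
  have hsub : Icc (S.τ 0) (S.τ 1) ⊆ Icc 0 (S.τ 1) := Icc_subset_Icc_left (S.τ_pos 0).le
  have hcl : IsClassicalNSSolutionOn (Icc (S.τ 0) (S.τ 0 + (S.τ 1 - S.τ 0))) 1 S.f s.u s.p := by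
    rw [e]
    exact s.classical.mono hsub (uniqueDiffOn_Icc (S.τ_lt_succ 0))
  have hen : ∃ C : ℝ≥0∞, C < ⊤ ∧ ∀ t ∈ Icc (S.τ 0) (S.τ 0 + (S.τ 1 - S.τ 0)),
      ∫⁻ x, ‖s.u t x‖ₑ ^ 2 ≤ C := by
    rw [e]
    obtain ⟨C, hC, hb⟩ := s.energy
    exact ⟨C, hC, fun t ht => hb t (hsub ht)⟩
  have hfo : ∀ t ∈ Icc (S.τ 0) (S.τ 0 + (S.τ 1 - S.τ 0)), ∀ x,
      ‖S.f t x‖ ≤ φ * TowerRates.wide.Y 0 ^ 3 := by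
    rw [e]
    intro t ht x
    have h3 : TowerRates.wide.Y 0 = forceAnch * TowerRates.wide.Y 0 ^ 3 := by
      simp only [forceAnch]
      field_simp
    calc ‖S.f t x‖ ≤ TowerRates.wide.Y 0 := force_le_Y_of_rigid hR 0 ht x
      _ = forceAnch * TowerRates.wide.Y 0 ^ 3 := h3
      _ ≤ φ * TowerRates.wide.Y 0 ^ 3 := mul_le_mul_of_nonneg_right hφ (by positivity)
  have hst : ∀ x, ‖s.u (S.τ 0) x‖ ≤ TowerRates.wide.Y 0 := by
    intro x
    have := s.norm_τ_zero_le x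
    rwa [hR.c₁_eq, one_mul] at this
  have hrun : ∀ t ∈ Icc (S.τ 0) (S.τ 0 + (S.τ 1 - S.τ 0)), ∀ x,
      ‖s.u t x‖ ≤ runAnch * TowerRates.wide.Y 0 := by
    rw [e]
    intro t ht x
    have h1 := s.ceiling 1 le_rfl t (hsub ht) x
    rw [hR.c₂_eq] at h1
    have h2 : runAnch * TowerRates.wide.Y 0 = (5 / 3 : ℝ) * TowerRates.wide.Y 1 := by
      simp only [runAnch]
      field_simp
    rw [h2]
    exact h1
  have key := hB (S.τ 0) (S.τ 1 - S.τ 0) (TowerRates.wide.Y 0) S.f s.u s.p hT hY0 hTm hcl hen hfo hst hrun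
  rw [e] at key
  obtain ⟨x, -, hx⟩ := s.floor 1 le_rfl
  rw [hR.c₁_eq, one_mul] at hx
  have hkx := key x
  have hfl : floorAnch * TowerRates.wide.Y 0 = TowerRates.wide.Y 1 := by
    simp only [floorAnch]
    field_simp
  have hlt : a * TowerRates.wide.Y 0 < floorAnch * TowerRates.wide.Y 0 := mul_lt_mul_of_pos_right ha hY0
  linarith

/-! ## §3 The dual doors, packaged (conditional refutations of `EpisodeBaseG`; nothing asserted) -/

/-- **Dual door G₀**: an explicit gradient-production constant `κ < gradFloorCeil 0 = 0.0578` at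
`s = windowCeil 0 = 3826.5`, valid for forces up to `forceCeil 0 · M³`, refutes the crux of record.
[cite: Palasek2026ElementaryModel, §3.3] -/
theorem not_episodeBaseG_of_gradientProductionBound {κ φ : ℝ} (hB : GradientProductionBound (windowCeil 0) φ κ)
    (hφ : forceCeil 0 ≤ φ) (hκ : κ < gradFloorCeil 0) : ¬ EpisodeBaseG :=
  not_episodeBaseG_of_noStageAbove_zero (gradientFaceNecessity 0 κ φ hB hφ hκ)

/-- **Dual door S₀** (start units): an explicit speed-amplification constant `a < floorOverStart 0 = 1.234` at
`(windowStart 0, runRatio 0) = (905.0, 2.056)` refutes the crux of record. [cite: Palasek2026ElementaryModel, §3.3] -/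
theorem not_episodeBaseG_of_speedAmplificationBound {a φ : ℝ}
    (hB : SpeedAmplificationBound (windowStart 0) (runRatio 0) φ a) (hφ : forceStart 0 ≤ φ)
    (ha : a < floorOverStart 0) : ¬ EpisodeBaseG :=
  not_episodeBaseG_of_noStageAbove_zero (speedFaceNecessity 0 a φ hB hφ ha)

/-- **Dual door S₀ᴬ** (anchored units): an explicit speed-amplification constant `a < floorAnch = 2.056` at
`(windowAnch, runAnch) = (325.8, 3.427)` refutes the crux of record. [cite: Palasek2026ElementaryModel, §3.3] -/
theorem not_episodeBaseG_of_speedAmplificationBound_anchored {a φ : ℝ}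
    (hB : SpeedAmplificationBound windowAnch runAnch φ a) (hφ : forceAnch ≤ φ) (ha : a < floorAnch) :
    ¬ EpisodeBaseG :=
  not_episodeBaseG_of_noStageAbove_zero (speedFaceNecessityAnchored a φ hB hφ ha)

/-- **Dual door G₁, read on the heredity items (sterile closure, flagged)**: a gradient bound below the window-`1`
floor ratio `gradFloorCeil 1 = 0.0481` empties level `2`, so `HeredityFrom 2` holds vacuously and — given the crux —
`HeredityAtOne` fails. [cite: Palasek2026ElementaryModel, §3.3] -/
theorem heredityFrom_two_and_of_gradientProductionBound_one {κ φ : ℝ}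
    (hB : GradientProductionBound (windowCeil 1) φ κ) (hφ : forceCeil 1 ≤ φ) (hκ : κ < gradFloorCeil 1) :
    HeredityFrom 2 ∧ (EpisodeBaseG → ¬ HeredityAtOne) :=
  have h1 : NoStageAbove 1 := gradientFaceNecessity 1 κ φ hB hφ hκ
  ⟨h1.heredityFrom, fun hK => h1.not_heredityAtOne hK⟩

end UniversalFace

end Summit.NavierStokesRegularity.FluidComputer.PalasekTowerClayBridge

end
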